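import Summits.CriticalPhenomena.PercolationContinuityZ3.Theorems.PercNearOneGluingNoHeavyLowerTailHullPortCSHWorld
import HarnessLib

/-!
# `NoHeavyLowerTail` (stmt-CriticalPhenomena-4575) — conditioned slack hierarchy, level one: the unfolding identity (Lemma U, k = 1)

Support file (prover `prim-ineq-prove-5`; `--supports stmt-CriticalPhenomena-4575`); no definitions, named facts or sorries.
prim-hp-8's Lemma U (memo run/shared/lean/prim/prim-hp-8/PROOF-S5-ALL-R.md §3.3) at level `k = 1`, in the
"same weights, deleted pairs" bookkeeping of `…HullPortTADefs` / `…HullPortCSHDefs`: owner `x`, avoided set `Y`, decoy `d`,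
a target `u`, a constant `c`, `Ψ` any function of the open edge cluster of `x`.  With `Θ = (Ψ(C_x) − E[Ψ(C_x) | C_Y]) 1{x ↮ Y}`:
  `E[Θ 1{u ∈ C_x}] − c E[Θ 1{d ∈ C_x}] = E[Θ 1{u ↔ {x,d} ∖ C_Y}] + E[1{d ↮ x,Y} Φ(C_d) (1{u ∈ C_d} − c)]`
(`HullPort.lemmaU_one`; left side `taB(u) − c·taB(d)`, first right-hand term the world covariance `wsum` with the set target
`{u ↔ x} ∪ {u ↔ d}`, `Φ = cshPhi`).  Ingredients here: conditioning on `C_S` of a DEPLETED configuration (`set_sum_cond_sdiff_off`),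
Lemma Φ(a) (`sum_theta_sdiff_eq`: `E_η[Θ(η∖K̄)] = −Φ(K)`), and the Markov property at `C_d` (`sum_theta_decoy_eq_neg_phi`).
[cite: VandenbergHaggstromKahn2005, §2.1 Lemmas 2.3–2.4 (p. 10), §1 pp. 7–8 display (10) — corollaries (conditioning on a cluster)]
-/

noncomputable section

namespace Summit.CriticalPhenomena.PercolationContinuityZ3.Theorems

open MeasureTheory Set Literature.Probability.LatticeModels Literature.Probability.Percolation
open scoped Classical

variable {V : Type*}

namespace HullPort

open LonePortSum LonePortSumGeneral BHK2006 DecisionTree KNPreFKG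

section CSH

variable [Fintype V]

/-! ### Conditioning on `C_d` and Lemma Φ(a) -/

/-- **Conditioning on `C_S` of a DEPLETED configuration**: given `{C_S(η ∖ B) = W}`, the configuration `η` off `S̄(W)`
(pairs of `B` included) is fresh.  [cite: VandenbergHaggstromKahn2005, §2.1 Lemmas 2.3–2.4 (p. 10) — corollary] -/
theorem set_sum_cond_sdiff_off (w : Sym2 V → ℝ) (hm : ∑ ω, weight w ω = 1) (S : Set V) (B : Set (Sym2 V))
    (K : Set (Sym2 V) → Set (Sym2 V) → ℝ) :
    ∑ η, weight w η * K (setCl (η \ B) S) (η \ barOf S (setCl (η \ B) S)) =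
      ∑ η, weight w η * ∑ ξ, weight w ξ * K (setCl (η \ B) S) (ξ \ barOf S (setCl (η \ B) S)) := by
  classical
  have hin : ∀ (A η : Set (Sym2 V)), (η \ B) ∩ A = (η ∩ A) \ B := fun A η => by
    ext e; simp only [Set.mem_inter_iff, Set.mem_sdiff]; tauto
  have key : ∀ W : Set (Sym2 V),
      ∑ η, (if setCl (η \ B) S = W then weight w η * K W (η \ barOf S W) else 0) =
      ∑ η, (if setCl (η \ B) S = W then weight w η * ∑ ξ, weight w ξ * K W (ξ \ barOf S W) else 0) := by
    intro W
    set A : Set (Sym2 V) := barOf S W with hA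
    set Φ : Set (Sym2 V) → Set (Sym2 V) → ℝ := fun ζ η => if setCl (ζ \ B) S = W then K W η else 0 with hΦ
    have hev : ∀ η : Set (Sym2 V), (setCl ((η ∩ A) \ B) S = W) ↔ (setCl (η \ B) S = W) := fun η => by
      rw [← hin, hA, setCl_inter_barOf_eq_iff]
    have h1 : ∀ η, (if setCl (η \ B) S = W then weight w η * K W (η \ A) else 0) = weight w η * Φ (η ∩ A) (η \ A) := by
      intro η
      simp only [hΦ, hev η]
      split_ifs <;> simp
    have h2 : ∀ η, weight w η * ∑ ξ, weight w ξ * Φ (η ∩ A) (ξ \ A) =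
        (if setCl (η \ B) S = W then weight w η * ∑ ξ, weight w ξ * K W (ξ \ A) else 0) := by
      intro η
      simp only [hΦ, hev η]
      split_ifs <;> simp
    calc ∑ η, (if setCl (η \ B) S = W then weight w η * K W (η \ A) else 0)
        = (∑ η, weight w η) * ∑ η, weight w η * Φ (η ∩ A) (η \ A) := by
          rw [hm, one_mul]; exact Finset.sum_congr rfl fun η _ => h1 η
      _ = ∑ η, weight w η * ∑ ξ, weight w ξ * Φ (η ∩ A) (ξ \ A) := blockFubini w A Φ
      _ = _ := Finset.sum_congr rfl fun η _ => h2 η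
  calc ∑ η, weight w η * K (setCl (η \ B) S) (η \ barOf S (setCl (η \ B) S))
      = ∑ η, ∑ W, (if setCl (η \ B) S = W then weight w η * K W (η \ barOf S W) else 0) :=
        Finset.sum_congr rfl fun η _ =>
          (Fintype.sum_ite_eq (setCl (η \ B) S) fun W => weight w η * K W (η \ barOf S W)).symm
    _ = ∑ W, ∑ η, (if setCl (η \ B) S = W then weight w η * K W (η \ barOf S W) else 0) := Finset.sum_comm
    _ = ∑ W, ∑ η, (if setCl (η \ B) S = W then weight w η * ∑ ξ, weight w ξ * K W (ξ \ barOf S W) else 0) :=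
        Finset.sum_congr rfl fun W _ => key W
    _ = ∑ η, ∑ W, (if setCl (η \ B) S = W then weight w η * ∑ ξ, weight w ξ * K W (ξ \ barOf S W) else 0) :=
        Finset.sum_comm
    _ = _ := Finset.sum_congr rfl fun η _ =>
        Fintype.sum_ite_eq (setCl (η \ B) S) fun W => weight w η * ∑ ξ, weight w ξ * K W (ξ \ barOf S W)

/-- **Lemma Φ(a)** (prim-hp-8): for every pair set `B`, `E_η[Θ(η ∖ B)] = −Φ`, i.e.
`Σ_η w 1{x↮Y}(η∖B) (Ψ(C_x((η∖B) ∖ cut_Y(η∖B))) − E_ξ Ψ(C_x(ξ ∖ cut_Y(η∖B)))) = −Σ_η w 1{x↮Y}(η∖B)(Ψ(C_x(η ∖ cut_Y(η∖B))) − Ψ(C_x(η∖B)))`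
(independence of `{C_Y(η∖B) = W}` from the configuration off `Ȳ(W)`).
(transcription of the cell memo prim-hp-8 PROOF-S5-ALL-R.md §3.2(a)) [cite: VandenbergHaggstromKahn2005, §2.1 Lemma 2.4 (p. 10) — corollary] -/
theorem sum_theta_sdiff_eq (w : Sym2 V → ℝ) (hm : ∑ ω, weight w ω = 1) (x : V) (Y : Set V)
    (Ψ : Set (Sym2 V) → ℝ) (B : Set (Sym2 V)) :
    ∑ η, weight w η * (ind (avoidEv x Y) (η \ B) *
        (Ψ (openEdgeCluster ((η \ B) \ cut Y (η \ B)) x) - delE w (cut Y (η \ B)) (fun ζ => Ψ (openEdgeCluster ζ x)))) =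
      -∑ η, weight w η * (ind (avoidEv x Y) (η \ B) *
        (Ψ (openEdgeCluster (η \ cut Y (η \ B)) x) - Ψ (openEdgeCluster (η \ B) x))) := by
  set I : Set (Set (Sym2 V)) := {W | ¬ (x ∈ Y ∨ ∃ e ∈ W, x ∈ e)} with hI
  -- the first term: `x ↮ Y` in `η ∖ B`, so deleting `cut_Y(η∖B)` does not change `C_x(η∖B)`
  have e1 : ∀ η : Set (Sym2 V), ind (avoidEv x Y) (η \ B) * Ψ (openEdgeCluster ((η \ B) \ cut Y (η \ B)) x) =
      ind (avoidEv x Y) (η \ B) * Ψ (openEdgeCluster (η \ B) x) := by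
    intro η
    by_cases h : η \ B ∈ avoidEv x Y
    · rw [openEdgeCluster_sdiff_cut_of_avoid Y (η \ B) (fun y hy hyx => h y hy hyx.symm)]
    · rw [ind_of_not_mem h, zero_mul, zero_mul]
  -- the second term: conditioning on `C_Y(η ∖ B)`
  have k := set_sum_cond_sdiff_off w hm Y B (fun W ζ => ind I W * Ψ (openEdgeCluster ζ x))
  have e2 : ∑ η, weight w η * (ind (avoidEv x Y) (η \ B) * Ψ (openEdgeCluster (η \ cut Y (η \ B)) x)) =
      ∑ η, weight w η * (ind (avoidEv x Y) (η \ B) * delE w (cut Y (η \ B)) (fun ζ => Ψ (openEdgeCluster ζ x))) := by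
    calc ∑ η, weight w η * (ind (avoidEv x Y) (η \ B) * Ψ (openEdgeCluster (η \ cut Y (η \ B)) x))
        = ∑ η, weight w η * (ind I (setCl (η \ B) Y) * Ψ (openEdgeCluster (η \ barOf Y (setCl (η \ B) Y)) x)) :=
          Finset.sum_congr rfl fun η _ => by rw [ind_avoidEv_eq_ind_setCl, cut_eq_barOf]
      _ = _ := k
      _ = _ := Finset.sum_congr rfl fun η _ => by
          rw [ind_avoidEv_eq_ind_setCl, cut_eq_barOf]
          simp only [delE, Finset.mul_sum]
          exact Finset.sum_congr rfl fun ξ _ => by ring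
  have lhs : ∑ η, weight w η * (ind (avoidEv x Y) (η \ B) *
      (Ψ (openEdgeCluster ((η \ B) \ cut Y (η \ B)) x) - delE w (cut Y (η \ B)) (fun ζ => Ψ (openEdgeCluster ζ x)))) =
      ∑ η, weight w η * (ind (avoidEv x Y) (η \ B) * Ψ (openEdgeCluster (η \ B) x)) -
        ∑ η, weight w η * (ind (avoidEv x Y) (η \ B) * delE w (cut Y (η \ B)) (fun ζ => Ψ (openEdgeCluster ζ x))) := by
    rw [← Finset.sum_sub_distrib]; refine Finset.sum_congr rfl fun η _ => ?_; rw [mul_sub, mul_sub, e1 η]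
  have rhs : -∑ η, weight w η * (ind (avoidEv x Y) (η \ B) *
      (Ψ (openEdgeCluster (η \ cut Y (η \ B)) x) - Ψ (openEdgeCluster (η \ B) x))) =
      ∑ η, weight w η * (ind (avoidEv x Y) (η \ B) * Ψ (openEdgeCluster (η \ B) x)) -
        ∑ η, weight w η * (ind (avoidEv x Y) (η \ B) * Ψ (openEdgeCluster (η \ cut Y (η \ B)) x)) := by
    rw [← Finset.sum_sub_distrib, ← Finset.sum_neg_distrib]; refine Finset.sum_congr rfl fun η _ => ?_; ring
  rw [lhs, rhs, e2]

omit [Fintype V] in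
/-- Deleting the cut set of `{d}` does not change the cut set of a set `Y` that `d` does not reach. [folklore] -/
theorem cut_sdiff_cut_singleton_of_avoid (Y : Set V) (d : V) (ω : Set (Sym2 V))
    (hd : ∀ y ∈ Y, ¬ (openGraph ω).Reachable d y) : cut Y (ω \ cut {d} ω) = cut Y ω := by
  ext e
  simp only [cut, Set.mem_setOf_eq]
  constructor
  · rintro ⟨v, hv, y, hy, hyv⟩
    exact ⟨v, hv, y, hy, hyv.mono (openGraph_le Set.sdiff_subset)⟩
  · rintro ⟨v, hv, y, hy, hyv⟩
    refine ⟨v, hv, y, hy, (reachable_sdiff_cut_iff_of_avoid {d} ω (a := y) ?_ v).2 hyv⟩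
    intro t ht; rw [Set.mem_singleton_iff] at ht; subst ht
    exact fun h => hd y hy h

/-- `Θ` is unchanged by deleting the cut set of a decoy `d ↮ x, Y`. [folklore] -/
theorem theta_sdiff_cut_decoy (w : Sym2 V → ℝ) (x d : V) (Y : Set V) (Ψ : Set (Sym2 V) → ℝ) (ω : Set (Sym2 V))
    (hdx : ¬ (openGraph ω).Reachable d x) (hdY : ∀ y ∈ Y, ¬ (openGraph ω).Reachable d y) :
    ind (avoidEv x Y) (ω \ cut {d} ω) * (Ψ (openEdgeCluster ((ω \ cut {d} ω) \ cut Y (ω \ cut {d} ω)) x) -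
        delE w (cut Y (ω \ cut {d} ω)) (fun ζ => Ψ (openEdgeCluster ζ x))) =
      ind (avoidEv x Y) ω * (Ψ (openEdgeCluster (ω \ cut Y ω) x) - delE w (cut Y ω) (fun ζ => Ψ (openEdgeCluster ζ x))) := by
  have hxd : ∀ t ∈ ({d} : Set V), ¬ (openGraph ω).Reachable t x := by
    intro t ht; rw [Set.mem_singleton_iff] at ht; subst ht; exact hdx
  have hrx := reachable_sdiff_cut_iff_of_avoid {d} ω hxd
  have hav : ind (avoidEv x Y) (ω \ cut {d} ω) = ind (avoidEv x Y) ω := by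
    by_cases h : ω ∈ avoidEv x Y
    · rw [ind_of_mem h, ind_of_mem (show ω \ cut {d} ω ∈ avoidEv x Y from fun y hy hh => h y hy ((hrx y).1 hh))]
    · rw [ind_of_not_mem h, ind_of_not_mem (show ω \ cut {d} ω ∉ avoidEv x Y from
        fun hh => h fun y hy hxy => hh y hy ((hrx y).2 hxy))]
  rw [hav, cut_sdiff_cut_singleton_of_avoid Y d ω hdY]
  -- `(ω ∖ cut_d) ∖ cut_Y = (ω ∖ cut_Y) ∖ cut_d(ω ∖ cut_Y)` and `x ↮ d` there
  have hdY' : ∀ y ∈ Y, ¬ (openGraph ω).Reachable y d := fun y hy h => hdY y hy h.symm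
  have hcd : cut {d} (ω \ cut Y ω) = cut {d} ω := by
    ext e
    simp only [cut, Set.mem_setOf_eq, Set.mem_singleton_iff, exists_eq_left]
    constructor
    · rintro ⟨v, hv, hdv⟩; exact ⟨v, hv, hdv.mono (openGraph_le Set.sdiff_subset)⟩
    · rintro ⟨v, hv, hdv⟩; exact ⟨v, hv, (reachable_sdiff_cut_iff_of_avoid Y ω hdY' v).2 hdv⟩
  have hset : (ω \ cut {d} ω) \ cut Y ω = (ω \ cut Y ω) \ cut {d} (ω \ cut Y ω) := by
    rw [hcd, Set.sdiff_sdiff, Set.sdiff_sdiff, Set.union_comm]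
  have hdx' : ¬ (openGraph (ω \ cut Y ω)).Reachable d x := fun h => hdx (h.mono (openGraph_le Set.sdiff_subset))
  have hcl : openEdgeCluster ((ω \ cut Y ω) \ cut {d} (ω \ cut Y ω)) x = openEdgeCluster (ω \ cut Y ω) x :=
    openEdgeCluster_sdiff_cut_of_avoid {d} (ω \ cut Y ω) (a := x) (by
      intro t ht; rw [Set.mem_singleton_iff] at ht; subst ht; exact hdx')
  rw [hset, hcl]

omit [Fintype V] in
/-- `1{d ↮ T}` read off the edge cluster of `d`. [folklore] -/
theorem ind_avoidEv_eq_ind_setCl_singleton (d : V) (T : Set V) (ω : Set (Sym2 V)) :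
    ind (avoidEv d T) ω = ind {W : Set (Sym2 V) | ∀ t ∈ T, ¬ (t ∈ ({d} : Set V) ∨ ∃ e ∈ W, t ∈ e)} (setCl ω {d}) := by
  by_cases h : ω ∈ avoidEv d T
  · rw [ind_of_mem h, ind_of_mem (show setCl ω {d} ∈ {W : Set (Sym2 V) | ∀ t ∈ T, ¬ (t ∈ ({d} : Set V) ∨ ∃ e ∈ W, t ∈ e)}
      from fun t ht hh => h t ht ((reachable_iff_setCl_singleton ω d t).2 hh))]
  · rw [ind_of_not_mem h, ind_of_not_mem (show setCl ω {d} ∉ {W : Set (Sym2 V) | ∀ t ∈ T, ¬ (t ∈ ({d} : Set V) ∨ ∃ e ∈ W, t ∈ e)}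
      from fun hh => h fun t ht hdt => hh t ht ((reachable_iff_setCl_singleton ω d t).1 hdt))]

omit [Fintype V] in
/-- `1{d ↔ u}` read off the edge cluster of `d`. [folklore] -/
theorem ind_openConn_eq_ind_setCl_singleton (d u : V) (ω : Set (Sym2 V)) :
    ind (openConn d u : Set (BondConfig V)) ω = ind {W : Set (Sym2 V) | u ∈ ({d} : Set V) ∨ ∃ e ∈ W, u ∈ e} (setCl ω {d}) := by
  by_cases h : (openGraph ω).Reachable d u
  · rw [ind_of_mem (show ω ∈ (openConn d u : Set (BondConfig V)) from h),
      ind_of_mem (show setCl ω {d} ∈ {W : Set (Sym2 V) | u ∈ ({d} : Set V) ∨ ∃ e ∈ W, u ∈ e} from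
        (reachable_iff_setCl_singleton ω d u).1 h)]
  · rw [ind_of_not_mem (show ω ∉ (openConn d u : Set (BondConfig V)) from h),
      ind_of_not_mem (show setCl ω {d} ∉ {W : Set (Sym2 V) | u ∈ ({d} : Set V) ∨ ∃ e ∈ W, u ∈ e} from
        fun hh => h ((reachable_iff_setCl_singleton ω d u).2 hh))]

/-- **The decoy term, conditioned on `C_d`** (Markov at `C_d` + Lemma Φ(a)):
`Σ_ω w Θ(ω) 1{d↮x,Y}(1{d↔u} − c) = −Σ_ω w 1{d↮x,Y} Φ(C_d)(1{d↔u} − c)`.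
(transcription of the cell memo prim-hp-8 PROOF-S5-ALL-R.md §3.3, "E_{ρ_j}[Θ(1_w − c_j(w))] = −Cov(Φ,1_w)")
[cite: VandenbergHaggstromKahn2005, §2.1 Lemma 2.4 (p. 10) — corollary] -/
theorem sum_theta_decoy_eq_neg_phi (w : Sym2 V → ℝ) (hm : ∑ ω, weight w ω = 1) (x d u : V) (Y : Set V) (c : ℝ)
    (Ψ : Set (Sym2 V) → ℝ) :
    ∑ ω, weight w ω * (ind (avoidEv x Y) ω * ((Ψ (openEdgeCluster (ω \ cut Y ω) x) -
        delE w (cut Y ω) (fun ζ => Ψ (openEdgeCluster ζ x))) *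
        (ind (avoidEv d (insert x Y)) ω * (ind (openConn d u : Set (BondConfig V)) ω - c)))) =
      -∑ ω, weight w ω * (ind (avoidEv d (insert x Y)) ω *
        (cshPhi w x d Y Ψ (openEdgeCluster ω d) * (ind (openConn d u : Set (BondConfig V)) ω - c))) := by
  set I₁ : Set (Set (Sym2 V)) := {W | ∀ t ∈ insert x Y, ¬ (t ∈ ({d} : Set V) ∨ ∃ e ∈ W, t ∈ e)} with hI₁
  set I₂ : Set (Set (Sym2 V)) := {W | u ∈ ({d} : Set V) ∨ ∃ e ∈ W, u ∈ e} with hI₂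
  set Θ : Set (Sym2 V) → ℝ := fun ζ => ind (avoidEv x Y) ζ * (Ψ (openEdgeCluster (ζ \ cut Y ζ) x) -
    delE w (cut Y ζ) (fun ζ' => Ψ (openEdgeCluster ζ' x))) with hΘ
  have k := set_sum_cond_sdiff w hm {d} (fun W ζ => ind I₁ W * (ind I₂ W - c) * Θ ζ)
  -- left side as the kernel sum
  have lhs : ∑ ω, weight w ω * (ind (avoidEv x Y) ω * ((Ψ (openEdgeCluster (ω \ cut Y ω) x) -
      delE w (cut Y ω) (fun ζ => Ψ (openEdgeCluster ζ x))) *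
      (ind (avoidEv d (insert x Y)) ω * (ind (openConn d u : Set (BondConfig V)) ω - c)))) =
      ∑ ω, weight w ω * (ind I₁ (setCl ω {d}) * (ind I₂ (setCl ω {d}) - c) * Θ (ω \ barOf {d} (setCl ω {d}))) := by
    refine Finset.sum_congr rfl fun ω _ => ?_
    rw [← ind_avoidEv_eq_ind_setCl_singleton, ← ind_openConn_eq_ind_setCl_singleton, ← cut_eq_barOf]
    by_cases hE : ω ∈ avoidEv d (insert x Y)
    · have hdx : ¬ (openGraph ω).Reachable d x := hE x (Set.mem_insert _ _)
      have hdY' : ∀ y ∈ Y, ¬ (openGraph ω).Reachable d y := fun y hy => hE y (Set.mem_insert_of_mem _ hy)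
      have hθ := theta_sdiff_cut_decoy w x d Y Ψ ω hdx hdY'
      simp only [hΘ]
      rw [hθ]; ring
    · rw [ind_of_not_mem hE]; ring
  -- the inner sum is `−Φ(C_d)`
  have inner : ∀ ω : Set (Sym2 V), ∑ η, weight w η * Θ (η \ barOf {d} (setCl ω {d})) =
      -cshPhi w x d Y Ψ (openEdgeCluster ω d) := by
    intro ω
    rw [setCl_singleton]
    have h := sum_theta_sdiff_eq w hm x Y Ψ (barOf {d} (openEdgeCluster ω d))
    simp only [hΘ, cshPhi] at h ⊢
    rw [h]
  rw [lhs, k, ← Finset.sum_neg_distrib]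
  refine Finset.sum_congr rfl fun ω _ => ?_
  have : ∑ η, weight w η * (ind I₁ (setCl ω {d}) * (ind I₂ (setCl ω {d}) - c) * Θ (η \ barOf {d} (setCl ω {d}))) =
      ind I₁ (setCl ω {d}) * (ind I₂ (setCl ω {d}) - c) * ∑ η, weight w η * Θ (η \ barOf {d} (setCl ω {d})) := by
    rw [Finset.mul_sum]; exact Finset.sum_congr rfl fun η _ => by ring
  rw [this, inner, ← ind_avoidEv_eq_ind_setCl_singleton, ← ind_openConn_eq_ind_setCl_singleton]
  ring

/-- **Lemma U at level one** (prim-hp-8, PROOF-S5-ALL-R.md §3.3, `k = 1`), for one target `u` and one constant `c`: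
`taB(u) − c·taB(d) = wsum(Ψ(C_x), 1{u↔x ∨ u↔d}) + Σ_ω w 1{d ↮ x,Y} Φ(C_d) (1{d ↔ u} − c)`
— i.e. `E[Θ(1{u∈C_x} − c 1{d∈C_x})] = E[Θ 1{u ↔ {x,d}∖C_Y}] − μ(E₁)·E_{ρ₁}[θ(C_d)(1{u∈C_d} − c)]` with `θ = −Φ`.
The margin of the level-one hierarchy is `[this at (u,c) = (o, c(o))] − p·[this at (v, c(v))]`.
[cite: VandenbergHaggstromKahn2005, §2.1 Lemmas 2.3–2.4 (p. 10) — corollaries; transcription of prim-hp-8's Lemma U] -/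
theorem lemmaU_one (w : Sym2 V → ℝ) (hm : ∑ ω, weight w ω = 1) (x d u : V) (Y : Set V) (Ψ : Set (Sym2 V) → ℝ) (c : ℝ)
    (hdx : d ≠ x) (hdu : d ≠ u) :
    taB w x u Y Ψ - c * taB w x d Y Ψ =
      wsum w x Y (fun η => Ψ (openEdgeCluster η x)) (ind (openConn x u ∪ openConn d u : Set (BondConfig V))) +
        ∑ ω, weight w ω * (ind (avoidEv d (insert x Y)) ω *
          (cshPhi w x d Y Ψ (openEdgeCluster ω d) * (ind (openConn d u : Set (BondConfig V)) ω - c))) := by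
  have step1 : taB w x u Y Ψ - c * taB w x d Y Ψ =
      wsum w x Y (fun η => Ψ (openEdgeCluster η x)) (ind (openConn x u ∪ openConn d u : Set (BondConfig V))) -
        ∑ ω, weight w ω * (ind (avoidEv x Y) ω * covW w Y (fun η => Ψ (openEdgeCluster η x))
          (fun η => ind (avoidEv d {x}) η * (ind (openConn d u : Set (BondConfig V)) η - c)) ω) := by
    simp only [taB, wsum, Finset.mul_sum, ← Finset.sum_sub_distrib]
    refine Finset.sum_congr rfl fun ω _ => ?_
    have h := taC_sub_smul_taC_eq w hm x d u Y Ψ c ω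
    calc weight w ω * (ind (avoidEv x Y) ω * taC w x u Y Ψ ω) - c * (weight w ω * (ind (avoidEv x Y) ω * taC w x d Y Ψ ω))
        = weight w ω * ind (avoidEv x Y) ω * (taC w x u Y Ψ ω - c * taC w x d Y Ψ ω) := by ring
      _ = _ := by rw [h]; ring
  rw [step1, sum_covW_decoy_eq w hm x d u Y c hdx hdu, sum_theta_decoy_eq_neg_phi w hm x d u Y c Ψ]
  ring

end CSH

end HullPort

end Summit.CriticalPhenomena.PercolationContinuityZ3.Theorems
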